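import Literature.NumberTheory.Automorphic.SymplecticSimilitudeIwasawa
import Literature.NumberTheory.Automorphic.SymplecticIwasawaCartan
import HarnessLib

/-!
# Iwasawa versus Cartan for `GSp_{2n}`: the exponents of the cosets in `K₀ t K₀` are dominated by those of `t`
# (Bruhat–Tits 1972, Prop. (4.4.4) (i), for the group of symplectic similitudes)

Topic `NumberTheory/Automorphic`; namespace `Literature.NumberTheory.Automorphic.SymplecticCartan` (lane `lit-hodgefound`,
Track 2 foundations; seat `lit-hodgefound-p11`, generation 37, row g37-#13).  THEOREMS ONLY: no definition, no named fact,
no instance, no notation.  Sequel of `SymplecticSimilitudeIwasawa` (`similitudeIwasawaExp hϖ g = (a(g), c(g)) ∈ ℤⁿ × ℤ`,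
`aᵢ = ord p_{inl i, inl i}`, `c = ord r(g)`), `SymplecticSimilitudeDoubleCosets` (the torus representatives
`similitudeTorusElt m a = diag(ϖ^m ϖ^{a}; ϖ^{-a})`, every double coset of `K₀ = GSp(J, 𝒪)` contains one) and the minor calculus
of `SymplecticIwasawaCartan` §1 (arbitrary index type).  The `GSp_{2n}` counterpart of `SymplecticIwasawaCartan`.

## The print

[BruhatTits1972] Prop. (4.4.4) (i): «Si `K.t.K ∩ B̂⁰.t'.K ≠ ∅`, on a `t' ≤ t`» — for `G = GSp_{2n}(K)`, `K = GSp_{2n}(𝒪)`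
and `t = diag(ϖ^m ϖ^{a}; ϖ^{-a})` DOMINANT FOR THE BOREL `B(K)` OF `SymplecticSimilitudeIwasawa` (stabiliser of the flag
`⟨e_{inr 0}, …⟩`), i.e. `a₀ ≥ a₁ ≥ ⋯ ≥ a_{n-1}` and `m + 2aᵢ ≥ 0` (the chamber opposite to the tree's normalisation «`a`
monotone, `m + 2aᵢ ≤ 0`» of `SymplecticSimilitudeDoubleCosets`, reached by conjugating with `J ∈ Sp(J, 𝒪)`): every coset
`γ ⊆ K₀ t K₀` has `c(γ) = m` and `Σ_{i<r} a(γ)ᵢ ≤ Σ_{i<r} (m + aᵢ) = Σ_{i<r} a(t)ᵢ`.  [Macdonald1995] Ch. II §1, Ch. V (2.6);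
[AndrianovZhuravlev1995] Ch. 3 §3 Lemma 3.6, §3.3 (the triangular representatives of the left cosets in `Γ₀ M Γ₀`).
PROOF: `g = p k`, `p = k₁ t k₂ k⁻¹`; the `inr`-corner `r × r` minor of `p` is `Π_{i<r} p_{inr i, inr i}` of valuation
`exp(Σ_{i<r} (a(g)ᵢ - m))` (`p_{inr i,inr i} p_{inl i,inl i} = r(p)`); every `r × r` minor of `k₁ t k₂ k⁻¹` has valuation
`≤ exp(Σ_{i<r} aᵢ)` — Cauchy–Binet and the combinatorial fact (§1) that among the exponents `{m + aᵢ} ∪ {-aᵢ}` of `t` any `r`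
distinct ones sum to at least `-Σ_{i<r} aᵢ` (exchange argument: `m + aᵢ ≥ -aⱼ` for all `i, j`).

## What is formalised (`K` a field with `Valued K ℤᵐ⁰`, uniformiser `ϖ`, `n ≠ 0` where cosets of `GSp` are concerned)

* §1 `sum_le_headSum_of_card_eq`, `headSum_le_sum_of_card_eq` (`r` distinct values of an antitone/monotone `ℤ`-vector
  against its head sum), **`neg_headSum_le_sum_elim`** (the exchange argument), **`prod_v_similitudeDiagonal_le`**.
* §2 `det_submatrix_inr_of_mem_symplecticSimilitudeBorel`, `v_apply_inl_eq_exp_neg_fst`, `v_multiplier_eq_exp_neg_snd`,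
  `v_apply_inr_eq_exp_sub` (`v(p_{inr i, inr i}) = exp(a(g)ᵢ - c(g))`).
* §3 **`snd_similitudeIwasawaExp_eq_of_mem_orbit`** (`c(γ) = m` on `K₀ t K₀`), **`sum_similitudeIwasawaExp_head_le`** —
  BRUHAT–TITS (4.4.4) (i) FOR `GSp_{2n}`.
* §4 `J_mul_diagonal_mul_neg_J`, `J_conj_similitudeTorusElt` (`J t(m, a') J⁻¹ = t(m, -a'-m)`),
  **`exists_dominant_similitudeTorusElt_mem_orbit`** — every coset lies in some `K₀ t(m, a) K₀` with `a` antitone and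
  `m + 2aᵢ ≥ 0` (the Cartan decomposition in the chamber of `B(K)`), `similitudeIwasawaExp_similitudeTorusElt'`.

## References
* [BruhatTits1972] F. Bruhat, J. Tits, *Groupes réductifs sur un corps local. I*, Publ. Math. IHÉS 41 (1972), Prop. (4.4.4).
* [Macdonald1995] I. G. Macdonald, *Symmetric Functions and Hall Polynomials*, 2nd ed. (1995), Ch. II §1; Ch. V (2.6).
* [AndrianovZhuravlev1995] A. N. Andrianov, V. G. Zhuravlev, *Modular Forms and Hecke Operators* (1995), Ch. 3 §3 Lemma 3.6,
  §3.3.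
-/

noncomputable section

open scoped Valued WithZero MatrixGroups
open Matrix Finset

namespace Literature.NumberTheory.Automorphic.SymplecticCartan

open Literature.NumberTheory.Automorphic.CartanUnique Literature.NumberTheory.Automorphic.HermitianLattice

variable {K : Type*} [Field K] {n : ℕ}

/-! ## §1 Head sums and the exchange argument -/

/-- **`r` distinct values of an antitone vector sum to at most its head sum** (`ℤ`-valued, exactly `r` indices).
[cite: Macdonald1995, Ch. I §1] -/
theorem sum_le_headSum_of_card_eq {f : Fin n → ℤ} (hf : Antitone f) {r : ℕ} (S : Finset (Fin n)) (hS : S.card = r) :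
    ∑ i ∈ S, f i ≤ ∑ i : Fin n, if (i : ℕ) < r then f i else 0 := by
  classical
  subst hS
  have hsum : ∑ i ∈ S, f i = ∑ j : Fin S.card, f (S.orderEmbOfFin rfl j) := by
    rw [← Finset.sum_coe_sort S, ← (S.orderIsoOfFin rfl).sum_comp]
    rfl
  rw [hsum]
  have hk : S.card ≤ n := S.card_le_univ.trans_eq (by simp)
  calc ∑ j : Fin S.card, f (S.orderEmbOfFin rfl j) ≤ ∑ j : Fin S.card, f (Fin.castLE hk j) := by
        refine Finset.sum_le_sum fun j _ => hf ?_
        rw [Fin.le_def, Fin.val_castLE]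
        exact le_apply_of_strictMono_fin (S.orderEmbOfFin rfl).strictMono j j.isLt
    _ = ∑ i : Fin n, if (i : ℕ) < S.card then f i else 0 := by
        rw [← Finset.sum_filter]
        refine Finset.sum_bij (fun j _ => Fin.castLE hk j) (fun j _ => ?_) (fun _ _ _ _ h => Fin.castLE_injective _ h)
          (fun i hi => ?_) (fun _ _ => rfl)
        · simp only [Finset.mem_filter, Finset.mem_univ, true_and, Fin.val_castLE]
          exact j.isLt
        · simp only [Finset.mem_filter, Finset.mem_univ, true_and] at hi
          exact ⟨⟨i, hi⟩, Finset.mem_univ _, Fin.ext rfl⟩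

/-- **`r` distinct values of a monotone vector sum to at least its head sum.** [cite: Macdonald1995, Ch. I §1] -/
theorem headSum_le_sum_of_card_eq {f : Fin n → ℤ} (hf : Monotone f) {r : ℕ} (S : Finset (Fin n)) (hS : S.card = r) :
    (∑ i : Fin n, if (i : ℕ) < r then f i else 0) ≤ ∑ i ∈ S, f i := by
  have h := sum_le_headSum_of_card_eq (f := fun i => -f i) (fun i j hij => neg_le_neg (hf hij)) S hS
  have h1 : (∑ i : Fin n, if (i : ℕ) < r then -f i else 0) = -∑ i : Fin n, if (i : ℕ) < r then f i else 0 := by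
    rw [← Finset.sum_neg_distrib]
    exact Finset.sum_congr rfl fun i _ => by split_ifs <;> simp
  rw [Finset.sum_neg_distrib, h1] at h
  exact neg_le_neg_iff.1 h

/-- **The exchange argument**: for `a` antitone with `m + 2aᵢ ≥ 0` and `T ⊆ Fin n ⊔ Fin n` with `|T| = r ≤ n`, the
exponents `e(inl i) = m + aᵢ`, `e(inr i) = -aᵢ` of `t(m, a)` satisfy `-Σ_{i<r} aᵢ ≤ Σ_{x∈T} e(x)` (replace every `inl i ∈ T`
by an unused `inr j`: `m + aᵢ ≥ -aⱼ`; then `r` distinct values of the monotone `-a`). [cite: Macdonald1995, Ch. II §1]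
[cite: BruhatTits1972, Prop. (4.4.4)] -/
theorem neg_headSum_le_sum_elim {a : Fin n → ℤ} (ha : Antitone a) {m : ℤ} (hm : ∀ i, 0 ≤ m + 2 * a i) {r : ℕ}
    (hr : r ≤ n) (T : Finset (Fin n ⊕ Fin n)) (hT : T.card = r) :
    -(∑ i : Fin n, if (i : ℕ) < r then a i else 0) ≤ ∑ x ∈ T, Sum.elim (fun i => m + a i) (fun i => -a i) x := by
  classical
  -- split `T` into its `inl`- and `inr`-indices
  set S₁ : Finset (Fin n) := Finset.univ.filter fun i => Sum.inl i ∈ T with hS₁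
  set S₂ : Finset (Fin n) := Finset.univ.filter fun i => Sum.inr i ∈ T with hS₂
  have hsplit : ∀ e : Fin n ⊕ Fin n → ℤ, ∑ x ∈ T, e x = ∑ i ∈ S₁, e (Sum.inl i) + ∑ i ∈ S₂, e (Sum.inr i) := fun e => by
    rw [← Finset.sum_filter_add_sum_filter_not T fun x => x ∈ T, Finset.filter_true_of_mem fun x hx => hx,
      Finset.filter_false_of_mem fun x hx => not_not_intro hx, Finset.sum_empty, add_zero, ← Finset.sum_ite_mem_eq,
      Fintype.sum_sum_type, hS₁, hS₂, Finset.sum_filter, Finset.sum_filter]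
  have hcard : S₁.card + S₂.card = r := by
    have h := hsplit fun _ => 1
    simp only [Finset.sum_const, nsmul_eq_mul, mul_one] at h
    rw [hT] at h
    exact_mod_cast h.symm
  -- an auxiliary set `S₁'` of `|S₁|` indices avoiding `S₂`
  obtain ⟨S₁', hS₁'sub, hS₁'card⟩ : ∃ S₁' ⊆ Finset.univ \ S₂, S₁'.card = S₁.card := by
    refine Finset.exists_subset_card_eq ?_
    rw [Finset.card_sdiff, Finset.inter_univ, Finset.card_univ, Fintype.card_fin]
    omega
  have hdisj : Disjoint S₁' S₂ := by
    rw [Finset.disjoint_iff_ne]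
    rintro i hi _ hj rfl
    exact (Finset.mem_sdiff.1 (hS₁'sub hi)).2 hj
  rw [hsplit]
  simp only [Sum.elim_inl, Sum.elim_inr]
  -- the case `n = 0` is trivial; otherwise compare with the constant `-a_{n-1}`
  rcases Nat.eq_zero_or_pos n with hn | hn
  · subst hn
    have h1 : S₁ = ∅ := Finset.eq_empty_of_isEmpty S₁
    have h2 : S₂ = ∅ := Finset.eq_empty_of_isEmpty S₂
    simp [h1, h2]
  set C : ℤ := -a ⟨n - 1, by omega⟩ with hC
  have hlow : ∀ j : Fin n, -a j ≤ C := fun j => neg_le_neg (ha (Fin.le_def.2 (by have := j.isLt; simp; omega)))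
  have hhigh : ∀ i : Fin n, C ≤ m + a i := fun i => by
    have h1 := hm ⟨n - 1, by omega⟩
    have h2 : a ⟨n - 1, by omega⟩ ≤ a i := ha (Fin.le_def.2 (by have := i.isLt; simp; omega))
    rw [hC]; omega
  calc -(∑ i : Fin n, if (i : ℕ) < r then a i else 0)
      = ∑ i : Fin n, if (i : ℕ) < r then -a i else 0 := by
        rw [← Finset.sum_neg_distrib]
        exact Finset.sum_congr rfl fun i _ => by split_ifs <;> simp
    _ ≤ ∑ i ∈ S₁' ∪ S₂, -a i :=
        headSum_le_sum_of_card_eq (fun i j hij => neg_le_neg (ha hij)) _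
          (by rw [Finset.card_union_of_disjoint hdisj, hS₁'card, hcard])
    _ = ∑ i ∈ S₁', -a i + ∑ i ∈ S₂, -a i := Finset.sum_union hdisj
    _ ≤ ∑ i ∈ S₁, (m + a i) + ∑ i ∈ S₂, -a i := by
        refine add_le_add ?_ le_rfl
        calc ∑ i ∈ S₁', -a i ≤ S₁'.card • C := Finset.sum_le_card_nsmul _ _ _ fun i _ => hlow i
          _ = S₁.card • C := by rw [hS₁'card]
          _ ≤ ∑ i ∈ S₁, (m + a i) := Finset.card_nsmul_le_sum _ _ _ fun i _ => hhigh i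

variable [Valued K ℤᵐ⁰] {ϖ : K}

/-- **The `r` largest entries of the torus representative** `t(m, a) = diag(ϖ^m ϖ^{a}; ϖ^{-a})`, `a` antitone, `m + 2aᵢ ≥ 0`,
`r ≤ n`: any `r` distinct diagonal entries have product of valuation `≤ exp(Σ_{i<r} aᵢ)`. [cite: Macdonald1995, Ch. II §1]
[cite: BruhatTits1972, Prop. (4.4.4)] -/
theorem prod_v_similitudeDiagonal_le (hϖ : Valued.v ϖ = WithZero.exp (-1 : ℤ)) {a : Fin n → ℤ} (ha : Antitone a) {m : ℤ}
    (hm : ∀ i, 0 ≤ m + 2 * a i) {r : ℕ} (hr : r ≤ n) (c : Fin r → Fin n ⊕ Fin n) (hc : Function.Injective c) :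
    ∏ j, Valued.v (Sum.elim (fun i => ϖ ^ m * ϖ ^ a i) (fun i => ϖ ^ (-a i)) (c j)) ≤
      WithZero.exp (∑ i : Fin n, if (i : ℕ) < r then a i else 0) := by
  classical
  have hϖ0 := uniformizer_ne_zero hϖ
  have hfac : ∀ x : Fin n ⊕ Fin n, Valued.v (Sum.elim (fun i => ϖ ^ m * ϖ ^ a i) (fun i => ϖ ^ (-a i)) x) =
      WithZero.exp (-Sum.elim (fun i => m + a i) (fun i => -a i) x) := by
    rintro (i | i)
    · rw [Sum.elim_inl, Sum.elim_inl, ← zpow_add₀ hϖ0, v_uniformizer_zpow hϖ]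
    · rw [Sum.elim_inr, Sum.elim_inr, v_uniformizer_zpow hϖ]
  simp_rw [hfac]
  rw [prod_exp_neg_eq, WithZero.exp_le_exp, neg_le, ← Finset.sum_image fun x _ y _ h => hc h]
  exact neg_headSum_le_sum_elim ha hm hr _ (by rw [Finset.card_image_of_injective _ hc]; simp)

/-! ## §2 The `inr`-corner minor of a Borel similitude -/

omit [Valued K ℤᵐ⁰] in
/-- **The `inr`-corner minor of `p ∈ B(K)`** is `Π_{i<r} p_{inr i, inr i}`. [cite: BruhatTits1972, Prop. (4.4.4)] -/
theorem det_submatrix_inr_of_mem_symplecticSimilitudeBorel {p : symplecticSimilitudeGroup (Fin n) K}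
    (hp : p ∈ symplecticSimilitudeBorel n K) {r : ℕ} (hr : r ≤ n) :
    ((((p : GL (Fin n ⊕ Fin n) K)) : Matrix (Fin n ⊕ Fin n) (Fin n ⊕ Fin n) K).submatrix
        (fun j : Fin r => Sum.inr (Fin.castLE hr j)) (fun j : Fin r => Sum.inr (Fin.castLE hr j))).det =
      ∏ j : Fin r, (((p : GL (Fin n ⊕ Fin n) K)) : Matrix (Fin n ⊕ Fin n) (Fin n ⊕ Fin n) K)
        (Sum.inr (Fin.castLE hr j)) (Sum.inr (Fin.castLE hr j)) := by
  obtain ⟨-, h₂, -⟩ := (blockTriangular_symplecticBorelOrder_iff _).1 (mem_symplecticSimilitudeBorel_iff.1 hp)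
  have htri : ((((p : GL (Fin n ⊕ Fin n) K)) : Matrix (Fin n ⊕ Fin n) (Fin n ⊕ Fin n) K).submatrix
      (fun j : Fin r => Sum.inr (Fin.castLE hr j)) (fun j : Fin r => Sum.inr (Fin.castLE hr j))).BlockTriangular id := by
    intro i j hij
    exact h₂ _ _ (Fin.lt_def.2 (by rw [Fin.val_castLE, Fin.val_castLE]; exact Fin.lt_def.1 hij))
  rw [Matrix.det_of_upperTriangular htri]
  rfl

variable [NeZero n]

/-- `v(p_{inl i, inl i}) = exp(-a(g)ᵢ)` for the Borel part `p` of `g = p k`. [cite: BruhatTits1972, §4.4 (4.4.3)] -/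
theorem v_apply_inl_eq_exp_neg_fst (hϖ : Valued.v ϖ = WithZero.exp (-1 : ℤ)) {g p k : symplecticSimilitudeGroup (Fin n) K}
    (hp : p ∈ symplecticSimilitudeBorel n K) (hk : k ∈ symplecticSimilitudeInt (Fin n) K) (h : g = p * k) (i : Fin n) :
    Valued.v (((p : GL (Fin n ⊕ Fin n) K) : Matrix (Fin n ⊕ Fin n) (Fin n ⊕ Fin n) K) (Sum.inl i) (Sum.inl i)) =
      WithZero.exp (-(similitudeIwasawaExp hϖ g).1 i) := by
  rw [fst_similitudeIwasawaExp_eq hϖ hp hk h i, neg_neg, WithZero.exp_log]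
  exact (Valuation.ne_zero_iff _).2 (apply_inl_ne_zero_of_mem_symplecticSimilitudeBorel hp i)

/-- `v(r(p)) = exp(-c(g))` for `g = p k`. [cite: AndrianovZhuravlev1995, Ch. 3 §3 (3.3)] -/
theorem v_multiplier_eq_exp_neg_snd (hϖ : Valued.v ϖ = WithZero.exp (-1 : ℤ)) {g p k : symplecticSimilitudeGroup (Fin n) K}
    (hk : k ∈ symplecticSimilitudeInt (Fin n) K) (h : g = p * k) :
    Valued.v (multiplier p : K) = WithZero.exp (-(similitudeIwasawaExp hϖ g).2) := by
  rw [snd_similitudeIwasawaExp, neg_neg, v_multiplier_eq_of_eq_mul hk h, WithZero.exp_log]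
  exact (Valuation.ne_zero_iff _).2 (multiplier p).ne_zero

/-- **`v(p_{inr i, inr i}) = exp(a(g)ᵢ - c(g))`** (`p_{inr i, inr i} p_{inl i, inl i} = r(p)`). [cite: AndrianovZhuravlev1995, Ch. 3 §3 Lemma 3.11] -/
theorem v_apply_inr_eq_exp_sub (hϖ : Valued.v ϖ = WithZero.exp (-1 : ℤ)) {g p k : symplecticSimilitudeGroup (Fin n) K}
    (hp : p ∈ symplecticSimilitudeBorel n K) (hk : k ∈ symplecticSimilitudeInt (Fin n) K) (h : g = p * k) (i : Fin n) :
    Valued.v (((p : GL (Fin n ⊕ Fin n) K) : Matrix (Fin n ⊕ Fin n) (Fin n ⊕ Fin n) K) (Sum.inr i) (Sum.inr i)) =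
      WithZero.exp ((similitudeIwasawaExp hϖ g).1 i - (similitudeIwasawaExp hϖ g).2) := by
  have h1 := congrArg Valued.v (apply_inr_mul_apply_inl_eq_multiplier hp i)
  rw [map_mul, v_apply_inl_eq_exp_neg_fst hϖ hp hk h i, v_multiplier_eq_exp_neg_snd hϖ hk h] at h1
  have h2 : WithZero.exp (-(similitudeIwasawaExp hϖ g).2) =
      WithZero.exp ((similitudeIwasawaExp hϖ g).1 i - (similitudeIwasawaExp hϖ g).2) *
        WithZero.exp (-(similitudeIwasawaExp hϖ g).1 i) := by
    rw [← WithZero.exp_add]; congr 1; ring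
  rw [h2] at h1
  exact mul_right_cancel₀ (WithZero.exp_ne_zero) h1

/-! ## §3 Bruhat–Tits (4.4.4) (i) for `GSp_{2n}` -/

/-- **The multiplier exponent is constant on a double coset**: `c(γ) = m` for `γ ⊆ K₀ t(m, a) K₀`.
[cite: AndrianovZhuravlev1995, Ch. 3 §3 (3.3), Lemma 3.6] -/
theorem snd_similitudeIwasawaExp_eq_of_mem_orbit (hϖ : Valued.v ϖ = WithZero.exp (-1 : ℤ)) {m : ℤ} {a : Fin n → ℤ}
    {g : symplecticSimilitudeGroup (Fin n) K}
    (hg : (g : symplecticSimilitudeGroup (Fin n) K ⧸ symplecticSimilitudeInt (Fin n) K) ∈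
      MulAction.orbit (symplecticSimilitudeInt (Fin n) K)
        ((similitudeTorusElt (uniformizer_ne_zero hϖ) m a : symplecticSimilitudeGroup (Fin n) K) :
          symplecticSimilitudeGroup (Fin n) K ⧸ symplecticSimilitudeInt (Fin n) K)) :
    (similitudeIwasawaExp hϖ g).2 = m := by
  haveI : Nonempty (Fin n) := ⟨⟨0, Nat.pos_of_ne_zero (NeZero.ne n)⟩⟩
  obtain ⟨A, hA, B, hB, hgAB⟩ := (heckeAlgebra.coe_mem_orbit_coe_iff (symplecticSimilitudeInt (Fin n) K) _ _).1 hg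
  rw [snd_similitudeIwasawaExp, hgAB, multiplier_mul, multiplier_mul, Units.val_mul, Units.val_mul, map_mul, map_mul,
    v_multiplier_eq_one_of_mem_symplecticSimilitudeInt hA, v_multiplier_eq_one_of_mem_symplecticSimilitudeInt hB, one_mul,
    mul_one, multiplier_similitudeTorusElt, v_uniformizer_zpow hϖ, WithZero.log_exp, neg_neg]

/-- **BRUHAT–TITS (4.4.4) (i) FOR `GSp_{2n}`**: if the coset `gK₀` lies in `K₀ t(m, a) K₀` with `a` antitone and
`m + 2aᵢ ≥ 0` (dominant for `B(K)`), then `Σ_{i<r} a(g)ᵢ ≤ Σ_{i<r} (m + aᵢ) = Σ_{i<r} a(t(m, a))ᵢ` for every `r`.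
[cite: BruhatTits1972, Prop. (4.4.4) (i)] [cite: Macdonald1995, Ch. V (2.6)] -/
theorem sum_similitudeIwasawaExp_head_le (hϖ : Valued.v ϖ = WithZero.exp (-1 : ℤ)) {m : ℤ} {a : Fin n → ℤ}
    (ha : Antitone a) (hm : ∀ i, 0 ≤ m + 2 * a i) {g : symplecticSimilitudeGroup (Fin n) K}
    (hg : (g : symplecticSimilitudeGroup (Fin n) K ⧸ symplecticSimilitudeInt (Fin n) K) ∈
      MulAction.orbit (symplecticSimilitudeInt (Fin n) K)
        ((similitudeTorusElt (uniformizer_ne_zero hϖ) m a : symplecticSimilitudeGroup (Fin n) K) :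
          symplecticSimilitudeGroup (Fin n) K ⧸ symplecticSimilitudeInt (Fin n) K))
    (r : ℕ) :
    (∑ i : Fin n, if (i : ℕ) < r then (similitudeIwasawaExp hϖ g).1 i else 0) ≤
      ∑ i : Fin n, if (i : ℕ) < r then m + a i else 0 := by
  -- reduce to `r ≤ n`
  wlog hr : r ≤ n generalizing r
  · have h := this n le_rfl
    have h1 : ∀ f : Fin n → ℤ, (∑ i : Fin n, if (i : ℕ) < r then f i else 0) = ∑ i : Fin n, if (i : ℕ) < n then f i else 0 :=
      fun f => Finset.sum_congr rfl fun i _ => by rw [if_pos (by omega), if_pos i.isLt]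
    rw [h1, h1]
    exact h
  have hc := snd_similitudeIwasawaExp_eq_of_mem_orbit hϖ hg
  obtain ⟨A, hA, B, hB, hgAB⟩ := (heckeAlgebra.coe_mem_orbit_coe_iff (symplecticSimilitudeInt (Fin n) K) _ _).1 hg
  obtain ⟨p, k, hp, hk, hpk⟩ := exists_mem_symplecticSimilitudeBorel_mul_symplecticSimilitudeInt hϖ g
  -- `p = A · t · B · k⁻¹` as matrices
  have hmat : (((p : GL (Fin n ⊕ Fin n) K)) : Matrix (Fin n ⊕ Fin n) (Fin n ⊕ Fin n) K) =
      (((A : GL (Fin n ⊕ Fin n) K)) : Matrix (Fin n ⊕ Fin n) (Fin n ⊕ Fin n) K) *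
        Matrix.diagonal (Sum.elim (fun i => ϖ ^ m * ϖ ^ a i) (fun i => ϖ ^ (-a i))) *
        (((B : GL (Fin n ⊕ Fin n) K)) : Matrix (Fin n ⊕ Fin n) (Fin n ⊕ Fin n) K) *
        ((((k : GL (Fin n ⊕ Fin n) K))⁻¹ : GL (Fin n ⊕ Fin n) K) : Matrix (Fin n ⊕ Fin n) (Fin n ⊕ Fin n) K) := by
    have hpk' : p = g * k⁻¹ := by rw [hpk, mul_inv_cancel_right]
    rw [hpk', hgAB, Subgroup.coe_mul, Subgroup.coe_inv, Subgroup.coe_mul, Subgroup.coe_mul, Units.val_mul, Units.val_mul,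
      Units.val_mul, coe_coe_similitudeTorusElt]
  have hmin := v_minor_le_of_eq_mul_diagonal_mul (prod_v_similitudeDiagonal_le hϖ ha hm hr)
    (mem_symplecticSimilitudeInt_iff.1 hA).1 (mem_symplecticSimilitudeInt_iff.1 hB).1 (mem_symplecticSimilitudeInt_iff.1 hk).2
    hmat (fun j : Fin r => Sum.inr (Fin.castLE hr j)) (fun j : Fin r => Sum.inr (Fin.castLE hr j))
  rw [det_submatrix_inr_of_mem_symplecticSimilitudeBorel hp hr, map_prod] at hmin
  simp_rw [v_apply_inr_eq_exp_sub hϖ hp hk hpk, hc] at hmin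
  have hprod : ∏ j : Fin r, WithZero.exp ((similitudeIwasawaExp hϖ g).1 (Fin.castLE hr j) - m) =
      WithZero.exp (∑ j : Fin r, ((similitudeIwasawaExp hϖ g).1 (Fin.castLE hr j) - m)) := by
    have h := prod_exp_neg_eq Finset.univ (fun j : Fin r => -((similitudeIwasawaExp hϖ g).1 (Fin.castLE hr j) - m))
    simpa only [neg_neg, Finset.sum_neg_distrib] using h
  have hre : ∀ f : Fin n → ℤ, ∑ j : Fin r, f (Fin.castLE hr j) = ∑ i : Fin n, if (i : ℕ) < r then f i else 0 := fun f => by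
    rw [← Finset.sum_filter]
    refine Finset.sum_bij (fun j _ => Fin.castLE hr j) (fun j _ => ?_) (fun _ _ _ _ h => Fin.castLE_injective _ h)
      (fun i hi => ?_) (fun _ _ => rfl)
    · simp only [Finset.mem_filter, Finset.mem_univ, true_and, Fin.val_castLE]
      exact j.isLt
    · simp only [Finset.mem_filter, Finset.mem_univ, true_and] at hi
      exact ⟨⟨i, hi⟩, Finset.mem_univ _, Fin.ext rfl⟩
  rw [hprod, WithZero.exp_le_exp, hre (fun i => (similitudeIwasawaExp hϖ g).1 i - m)] at hmin
  -- `Σ_{i<r} (a(g)_i - m) ≤ Σ_{i<r} a_i` ⟺ the claim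
  have hsub : ∀ f : Fin n → ℤ, (∑ i : Fin n, if (i : ℕ) < r then f i - m else 0) =
      (∑ i : Fin n, if (i : ℕ) < r then f i else 0) - ∑ i : Fin n, if (i : ℕ) < r then m else 0 := fun f => by
    rw [← Finset.sum_sub_distrib]
    exact Finset.sum_congr rfl fun i _ => by split_ifs <;> simp
  have hadd : (∑ i : Fin n, if (i : ℕ) < r then m + a i else 0) =
      (∑ i : Fin n, if (i : ℕ) < r then m else 0) + ∑ i : Fin n, if (i : ℕ) < r then a i else 0 := by
    rw [← Finset.sum_add_distrib]
    exact Finset.sum_congr rfl fun i _ => by split_ifs <;> simp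
  rw [hsub] at hmin
  rw [hadd]
  linarith

/-! ## §4 The Cartan decomposition in the chamber of `B(K)` -/

omit [Valued K ℤᵐ⁰] [NeZero n] in
/-- `J · diag(x; y) · (-J) = diag(y; x)` (the long Weyl element swaps the two blocks). [cite: AndrianovZhuravlev1995, Ch. 3 §3 Lemma 3.6] -/
theorem J_mul_diagonal_mul_neg_J (x y : Fin n → K) :
    Matrix.J (Fin n) K * Matrix.diagonal (Sum.elim x y) * (-Matrix.J (Fin n) K) = Matrix.diagonal (Sum.elim y x) := by
  rw [Matrix.J, ← Matrix.fromBlocks_diagonal, Matrix.fromBlocks_multiply, Matrix.fromBlocks_neg, Matrix.fromBlocks_multiply,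
    ← Matrix.fromBlocks_diagonal]
  simp

omit [Valued K ℤᵐ⁰] [NeZero n] in
/-- **`J t(m, a') J⁻¹ = t(m, -a' - m)`**: conjugating the torus representative by the long Weyl element `J ∈ Sp(J, 𝒪)` moves
it to the opposite chamber. [cite: AndrianovZhuravlev1995, Ch. 3 §3 Lemma 3.6] -/
theorem J_conj_similitudeTorusElt (hϖ0 : ϖ ≠ 0) (m : ℤ) (a' : Fin n → ℤ) :
    ofSymplectic ⟨Matrix.J (Fin n) K, SymplecticGroup.J_mem (Fin n) K⟩ * similitudeTorusElt hϖ0 m a' *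
        (ofSymplectic ⟨Matrix.J (Fin n) K, SymplecticGroup.J_mem (Fin n) K⟩)⁻¹ =
      (similitudeTorusElt hϖ0 m (fun i => -a' i - m) : symplecticSimilitudeGroup (Fin n) K) := by
  refine Subtype.ext (Units.ext ?_)
  rw [Subgroup.coe_mul, Subgroup.coe_mul, Subgroup.coe_inv, Units.val_mul, Units.val_mul, Matrix.coe_units_inv,
    coe_ofSymplectic, coe_coe_similitudeTorusElt, coe_coe_similitudeTorusElt, Matrix.J_inv, J_mul_diagonal_mul_neg_J]
  congr 1
  funext x
  rcases x with i | i
  · simp only [Sum.elim_inl]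
    rw [← zpow_add₀ hϖ0]; congr 1; ring
  · simp only [Sum.elim_inr]
    rw [← zpow_add₀ hϖ0]; congr 1; ring

/-- **The Cartan decomposition of `GSp_{2n}` in the chamber of `B(K)`**: every coset `γ₀ ∈ GSp(J, K)/GSp(J, 𝒪)` has some
`t(m, a) K₀` with `a` ANTITONE and `m + 2aᵢ ≥ 0` in its `K₀`-orbit (the tree's normal form `a` monotone, `m + 2aᵢ ≤ 0`,
conjugated by `J`). [cite: AndrianovZhuravlev1995, Ch. 3 §3 Lemma 3.6] [cite: BruhatTits1972, §4.4 (4.4.3)] -/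
theorem exists_dominant_similitudeTorusElt_mem_orbit (hϖ : Valued.v ϖ = WithZero.exp (-1 : ℤ))
    (γ₀ : symplecticSimilitudeGroup (Fin n) K ⧸ symplecticSimilitudeInt (Fin n) K) :
    ∃ (m : ℤ) (a : Fin n → ℤ), Antitone a ∧ (∀ i, 0 ≤ m + 2 * a i) ∧
      ((similitudeTorusElt (uniformizer_ne_zero hϖ) m a : symplecticSimilitudeGroup (Fin n) K) :
          symplecticSimilitudeGroup (Fin n) K ⧸ symplecticSimilitudeInt (Fin n) K) ∈
        MulAction.orbit (symplecticSimilitudeInt (Fin n) K) γ₀ := by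
  have hϖ0 := uniformizer_ne_zero hϖ
  obtain ⟨m, a', ha', hm', hmk⟩ := heckeCosetMk_similitudeTorusElt_eq hϖ γ₀.out
  obtain ⟨A, hA, B, hB, hAB⟩ := (heckeAlgebra.heckeCosetMk_eq_iff (symplecticSimilitudeInt (Fin n) K)
    (Submonoid.mem_top _) (Submonoid.mem_top _)).1 hmk
  -- `γ₀.out = A t(m,a') B`, and `t(m,a) = J t(m,a') J⁻¹` with `a = -a' - m`
  have hJK : ofSymplectic ⟨Matrix.J (Fin n) K, SymplecticGroup.J_mem (Fin n) K⟩ ∈ symplecticSimilitudeInt (Fin n) K :=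
    ofSymplectic_mem_symplecticSimilitudeInt J_mem_symplecticInt
  refine ⟨m, fun i => -a' i - m, fun i j hij => by have := ha' hij; dsimp only; omega,
    fun i => by have := hm' i; dsimp only; omega, ?_⟩
  rw [← J_conj_similitudeTorusElt hϖ0 m a', ← QuotientGroup.out_eq' γ₀, heckeAlgebra.coe_mem_orbit_coe_iff]
  refine ⟨ofSymplectic ⟨Matrix.J (Fin n) K, SymplecticGroup.J_mem (Fin n) K⟩ * A⁻¹,
    (symplecticSimilitudeInt (Fin n) K).mul_mem hJK ((symplecticSimilitudeInt (Fin n) K).inv_mem hA),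
    B⁻¹ * (ofSymplectic ⟨Matrix.J (Fin n) K, SymplecticGroup.J_mem (Fin n) K⟩)⁻¹,
    (symplecticSimilitudeInt (Fin n) K).mul_mem ((symplecticSimilitudeInt (Fin n) K).inv_mem hB)
      ((symplecticSimilitudeInt (Fin n) K).inv_mem hJK), ?_⟩
  rw [hAB]
  group

/-- The exponents of the dominant representative: `(a, c)(t(m, a)) = (m + a, m)` (restated from
`similitudeIwasawaExp_similitudeTorusElt`). [cite: Kottwitz1992, §7 Lemma 7.4] -/
theorem fst_similitudeIwasawaExp_similitudeTorusElt (hϖ : Valued.v ϖ = WithZero.exp (-1 : ℤ)) (m : ℤ) (a : Fin n → ℤ) :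
    (similitudeIwasawaExp hϖ (similitudeTorusElt (uniformizer_ne_zero hϖ) m a : symplecticSimilitudeGroup (Fin n) K)).1 =
      fun i => m + a i := by
  rw [similitudeIwasawaExp_similitudeTorusElt]

end Literature.NumberTheory.Automorphic.SymplecticCartan

end
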